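import Summits.QuantumFields.YangMills.Theorems.UnitScaleTiltProp7NestedMeanParallelLiftGauge
import Literature.MathematicalPhysics.QuantumFieldTheory.Balaban1983to89.B9AdOrthogonal
import HarnessLib

/-!
# Route `UnitScaleTilt`, crux K1 child «MinimiserStabilityRegPr» (stmt-QuantumFields-19200), stub `stub_existenceMinimalOrbit` (EX), line «SYM-CENTRE»
# (★★OWNER RULING g28-№7 cure (ii-a); px20 g2 LOCATE #56 §6 row (R1), second half «R1-DIAG-GAUGE», px20 22:06:49Z) — **A NON-ZERO HERMITIAN TRACELESS
# `V`-PARALLEL SECTION DIAGONALISES THE COARSE FIELD: there is a coarse `SU(2)` gauge `g` such that every bond variable of `g • V` COMMUTES WITH `σ₃`**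

Cell `ym3-torus`, width seat `ym3-torus-px6` (gen 3).  THEOREMS ONLY (0 `def`, 0 `sorry`).  `--supports stmt-QuantumFields-19200 --as helper`, count-neutral.
YM₃ on T³ is a ladder rung (R3), not the Clay problem; nothing here claims the stub, the crux, d = 4 or the mass gap.

THE POINT.  In the `SU(2)` commutant trichotomy of the SYM-CENTRE line (px20 #56 (V1)) the reducible coarse fields `V` (`p(V) ≥ 1`) are those admitting a
non-scalar `V♭`-parallel section; taking its Hermitian traceless part one may assume `h(y)` Hermitian, traceless, `V♭`-parallel and non-zero.  POINTWISE, a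
non-zero Hermitian traceless `2 × 2` matrix is `SU(2)`-conjugate to `λσ₃` with `λ > 0` (§1: Mathlib's spectral theorem `Matrix.IsHermitian.spectral_theorem`,
the determinant of the diagonaliser repaired by a diagonal phase, the sign of `λ` by the Weyl element `J = [[0,1],[−1,0]]`).  ALONG A BOND, parallelism
`h(e₋)·V(e) = V(e)·h(e₊)` gives `W·(λ₊σ₃) = (λ₋σ₃)·W` for the re-gauged bond variable `W = g(e₋)V(e)g(e₊)⁻¹`, and `λ₋ = λ₊` because `det h` is transported
(`det h(e₋) = det h(e₊)`, Mathlib `Matrix.det_units_conj`) and `λ > 0`; so `W` commutes with `σ₃` (§2).  This is the «σ₃-diagonalising coarse gauge» half of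
px20's (R1); its other half `hLift_of_parallelConstCommuting` (px20 ⧗) and the transport of `hSymCentre` along the gauge (✓`symCentre_gaugeAct`, §3 here in
the «undo the gauge» direction) are by name.
* §1 `det_smul_sigma3` (`det (λσ₃) = −λ²`), `J_mem_specialUnitaryGroup`, `J_conj_sigma3` (`Jσ₃J⋆ = −σ₃`), ★★`exists_su2_conj_eq_smul_sigma3`
  (`h` Hermitian, traceless, `≠ 0` ⇒ `∃ g ∈ SU(2), λ > 0, g h g⋆ = λσ₃`).
* §2 ★★★`exists_gauge_commute_sigma3_of_parallel` — for `V : T_{(n)} → SU(2)` and `h` Hermitian traceless `V♭`-parallel with `h ≠ 0` somewhere: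
  `∃ g, ∀ e, Commute ((g • V)(e) : M₂(ℂ)) σ₃` (non-vanishing propagates along bonds by the transported determinant; the torus is connected through
  ✓`const_of_shift_eq`).
* §3 `exists_symCentre_of_gaugeAct` — a symmetric regular centre for `w • V` gives one for `V` (✓`symCentre_gaugeAct` at `(liftTransfTo w)⁻¹`).
HONEST SCOPE.  Linear algebra and bookkeeping; no estimate; no stub ∕ crux statement is advanced; the abelian lift (R3)∕(R4) is the line's content.

References: T. Bałaban, CMP 99 (1985) 389–434 [Balaban1985BackgroundPropagators] ((3.19)–(3.21) pp.393–394: parallel sections of the background);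
CMP 98 (1985) 17–51 [Balaban1985Averaging] ((8)–(11) p.19); CMP 102 (1985) 277–309 [Balaban1985Variational] ((3)–(6) p.278).
-/

set_option autoImplicit false

noncomputable section

open scoped BigOperators Matrix.Norms.L2Operator Matrix

namespace Summit.QuantumFields.YangMills.Theorems.Prop7NestedMeanParallelLiftDiagGauge

open Literature.MathematicalPhysics.QuantumFieldTheory.Balaban1983to89
open T4Continuum BlockAveraging
open B10Eq27TorusAxialLog (unitsField toUField val_unitsField val_suIncl)
open B15DeterminingSets (embIter)
open B9AdOrthogonal (σ₃)
open Summit.QuantumFields.YangMills.Theorems.Prop8Chart (emlIterU)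
open Summit.QuantumFields.YangMills.BalabanUVNodes.N12FlatFibreNullSpace (const_of_shift_eq)
open B5Positivity172Lattice (TT ofT)
open Literature.MathematicalPhysics.QuantumFieldTheory.Balaban1983to89.T3ContinuumYM3Torus
open T3UnitLawDensityEML (ℰp)
open T3ConstrainedMinimiser (fibre)
open T3PrintedRegularMinimiser (RegPr)
open T3PrintedRegularOrbits (descTransf liftTransfTo descTransf_liftTransfTo)
open T3SectALandauChart (bgUnits CloseAvg)
open T3UnitLawGaugeInvariance (gaugeAct_gaugeAct)
open Summit.QuantumFields.YangMills.Theorems.Prop7NestedMeanParallelLift (symCentre_gaugeAct)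

/-! ## §1 `2 × 2` linear algebra: `SU(2)`-diagonalisation of a Hermitian traceless matrix -/

section Matrices

/-- `σ₃` unfolded. [folklore] -/
theorem sigma3_eq : σ₃ = !![1, 0; 0, -1] := rfl

/-- `det (λσ₃) = −λ²`. [folklore] -/
theorem det_smul_sigma3 (c : ℂ) : ((c • σ₃ : Matrix (Fin 2) (Fin 2) ℂ)).det = -c ^ 2 := by
  rw [sigma3_eq, Matrix.det_fin_two]
  simp; ring

/-- The Weyl element `J = [[0, 1], [−1, 0]]` lies in `SU(2)`. [folklore] -/
theorem J_mem_specialUnitaryGroup : (!![0, 1; -1, 0] : Matrix (Fin 2) (Fin 2) ℂ) ∈ Matrix.specialUnitaryGroup (Fin 2) ℂ := by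
  rw [Matrix.mem_specialUnitaryGroup_iff, Matrix.mem_unitaryGroup_iff, Matrix.det_fin_two]
  refine ⟨?_, by simp⟩
  ext i j
  fin_cases i <;> fin_cases j <;> simp [Matrix.mul_apply, Fin.sum_univ_two, Matrix.star_eq_conjTranspose]

/-- `J σ₃ J⋆ = −σ₃`. [folklore] -/
theorem J_conj_sigma3 : (!![0, 1; -1, 0] : Matrix (Fin 2) (Fin 2) ℂ) * σ₃ * star (!![0, 1; -1, 0] : Matrix (Fin 2) (Fin 2) ℂ) = -σ₃ := by
  rw [sigma3_eq]
  ext i j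
  fin_cases i <;> fin_cases j <;> simp [Matrix.mul_apply, Fin.sum_univ_two, Matrix.star_eq_conjTranspose]

/-- A diagonal phase `diag(ω̄, 1)` with `|ω| = 1` is unitary, has determinant `ω̄`, and fixes `σ₃` under conjugation. [folklore] -/
theorem phase_rows {ω : ℂ} (hω : ω * star ω = 1) :
    (Matrix.diagonal ![star ω, 1] : Matrix (Fin 2) (Fin 2) ℂ) * star (Matrix.diagonal ![star ω, 1]) = 1 ∧
      (Matrix.diagonal ![star ω, 1] : Matrix (Fin 2) (Fin 2) ℂ).det = star ω ∧
      (Matrix.diagonal ![star ω, 1] : Matrix (Fin 2) (Fin 2) ℂ) * σ₃ * star (Matrix.diagonal ![star ω, 1]) = σ₃ := by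
  have hω1 : (starRingEnd ℂ) ω * ω = 1 := by rw [mul_comm]; exact hω
  refine ⟨?_, ?_, ?_⟩
  · ext i j
    fin_cases i <;> fin_cases j <;> simp [Matrix.mul_apply, Matrix.star_eq_conjTranspose, Matrix.diagonal, hω1]
  · rw [Matrix.det_diagonal]; simp
  · rw [sigma3_eq]
    ext i j
    fin_cases i <;> fin_cases j <;> simp [Matrix.mul_apply, Fin.sum_univ_two, Matrix.star_eq_conjTranspose, Matrix.diagonal, hω1]

/-- ★★ **`SU(2)`-DIAGONALISATION OF A NON-ZERO HERMITIAN TRACELESS `2 × 2` MATRIX**: `∃ g ∈ SU(2)`, `λ > 0` with `g h g⋆ = λσ₃`.  Mathlib's spectral theorem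
gives a unitary `u₀` with `u₀ h u₀⋆ = diag(e₀, e₁)`, `e₀ + e₁ = tr h = 0`, `e₀ ≠ 0`; the phase `diag(det u₀⋆…)` repairs the determinant and the Weyl element the
sign. [folklore] -/
theorem exists_su2_conj_eq_smul_sigma3 (h : Matrix (Fin 2) (Fin 2) ℂ) (hh : h.IsHermitian) (htr : h.trace = 0) (h0 : h ≠ 0) :
    ∃ (g : Matrix.specialUnitaryGroup (Fin 2) ℂ) (lam : ℝ), 0 < lam ∧
      (g : Matrix (Fin 2) (Fin 2) ℂ) * h * star (g : Matrix (Fin 2) (Fin 2) ℂ) = (lam : ℂ) • σ₃ := by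
  classical
  -- the unitary diagonaliser of the spectral theorem, `u₀ := U⋆`
  set u₀ : Matrix (Fin 2) (Fin 2) ℂ := star (hh.eigenvectorUnitary : Matrix (Fin 2) (Fin 2) ℂ) with hu₀
  have hUmem : (hh.eigenvectorUnitary : Matrix (Fin 2) (Fin 2) ℂ) ∈ Matrix.unitaryGroup (Fin 2) ℂ := hh.eigenvectorUnitary.2
  have hUU : (hh.eigenvectorUnitary : Matrix (Fin 2) (Fin 2) ℂ) * star (hh.eigenvectorUnitary : Matrix (Fin 2) (Fin 2) ℂ) = 1 :=
    Matrix.mem_unitaryGroup_iff.1 hUmem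
  have hUU' : star (hh.eigenvectorUnitary : Matrix (Fin 2) (Fin 2) ℂ) * (hh.eigenvectorUnitary : Matrix (Fin 2) (Fin 2) ℂ) = 1 :=
    Matrix.mem_unitaryGroup_iff'.1 hUmem
  have hu₀u : u₀ * star u₀ = 1 := by rw [hu₀, star_star]; exact hUU'
  have hu₀u' : star u₀ * u₀ = 1 := by rw [hu₀, star_star]; exact hUU
  -- `u₀ h u₀⋆ = diag(e)`
  have hdiag : u₀ * h * star u₀ = Matrix.diagonal (fun i => ((hh.eigenvalues i : ℝ) : ℂ)) := by
    have h1 := hh.conjStarAlgAut_star_eigenvectorUnitary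
    simp only [Unitary.conjStarAlgAut_apply, Unitary.coe_star, star_star] at h1
    rw [hu₀, star_star]
    exact h1
  -- the eigenvalues: `e₁ = −e₀`, `e₀ ≠ 0`
  have hsum : hh.eigenvalues 1 = -hh.eigenvalues 0 := by
    have ht := hh.trace_eq_sum_eigenvalues
    rw [htr, Fin.sum_univ_two] at ht
    have : ((hh.eigenvalues 0 + hh.eigenvalues 1 : ℝ) : ℂ) = 0 := by push_cast; exact ht.symm
    have hre := Complex.ofReal_eq_zero.1 this
    linarith
  have hdiag' : u₀ * h * star u₀ = ((hh.eigenvalues 0 : ℝ) : ℂ) • σ₃ := by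
    rw [hdiag, sigma3_eq]
    ext i j
    fin_cases i <;> fin_cases j <;> simp [Matrix.diagonal, hsum]
  have he0 : hh.eigenvalues 0 ≠ 0 := by
    intro hz
    apply h0
    have hz' : u₀ * h * star u₀ = 0 := by rw [hdiag', hz]; simp
    have hback : star u₀ * (u₀ * h * star u₀) * u₀ = h := by
      calc star u₀ * (u₀ * h * star u₀) * u₀ = (star u₀ * u₀) * h * (star u₀ * u₀) := by simp only [mul_assoc]
        _ = h := by rw [hu₀u', one_mul, mul_one]
    rw [← hback, hz', mul_zero, zero_mul]
  -- the determinant phase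
  set ω : ℂ := u₀.det with hω
  have hωω : ω * star ω = 1 := by
    have h1 := congrArg Matrix.det hu₀u
    rwa [Matrix.det_mul, Matrix.star_eq_conjTranspose, Matrix.det_conjTranspose, Matrix.det_one] at h1
  obtain ⟨hDD, hDdet, hDσ⟩ := phase_rows hωω
  set D : Matrix (Fin 2) (Fin 2) ℂ := Matrix.diagonal ![star ω, 1] with hD
  -- `g₁ := D u₀ ∈ SU(2)` with `g₁ h g₁⋆ = e₀ σ₃`
  have hg₁U : D * u₀ * star (D * u₀) = 1 := by
    calc D * u₀ * star (D * u₀) = D * (u₀ * star u₀) * star D := by rw [star_mul]; simp only [mul_assoc]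
      _ = 1 := by rw [hu₀u, mul_one, hDD]
  have hg₁det : (D * u₀).det = 1 := by
    rw [Matrix.det_mul, hDdet, ← hω, mul_comm]; exact hωω
  have hg₁mem : D * u₀ ∈ Matrix.specialUnitaryGroup (Fin 2) ℂ :=
    Matrix.mem_specialUnitaryGroup_iff.2 ⟨Matrix.mem_unitaryGroup_iff.2 hg₁U, hg₁det⟩
  have hg₁conj : D * u₀ * h * star (D * u₀) = ((hh.eigenvalues 0 : ℝ) : ℂ) • σ₃ := by
    calc D * u₀ * h * star (D * u₀) = D * (u₀ * h * star u₀) * star D := by rw [star_mul]; simp only [mul_assoc]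
      _ = ((hh.eigenvalues 0 : ℝ) : ℂ) • (D * σ₃ * star D) := by rw [hdiag', Matrix.mul_smul, Matrix.smul_mul]
      _ = ((hh.eigenvalues 0 : ℝ) : ℂ) • σ₃ := by rw [hDσ]
  -- the sign
  rcases lt_or_gt_of_ne he0 with hneg | hpos
  · refine ⟨⟨!![0, 1; -1, 0] * (D * u₀), Submonoid.mul_mem _ J_mem_specialUnitaryGroup hg₁mem⟩, -hh.eigenvalues 0, by linarith, ?_⟩
    show !![0, 1; -1, 0] * (D * u₀) * h * star (!![0, 1; -1, 0] * (D * u₀)) = (((-hh.eigenvalues 0 : ℝ)) : ℂ) • σ₃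
    calc !![0, 1; -1, 0] * (D * u₀) * h * star (!![0, 1; -1, 0] * (D * u₀))
        = !![0, 1; -1, 0] * (D * u₀ * h * star (D * u₀)) * star !![0, 1; -1, 0] := by rw [star_mul]; simp only [mul_assoc]
      _ = ((hh.eigenvalues 0 : ℝ) : ℂ) • (!![0, 1; -1, 0] * σ₃ * star (!![0, 1; -1, 0] : Matrix (Fin 2) (Fin 2) ℂ)) := by
          rw [hg₁conj, Matrix.mul_smul, Matrix.smul_mul]
      _ = (((-hh.eigenvalues 0 : ℝ)) : ℂ) • σ₃ := by rw [J_conj_sigma3, smul_neg, Complex.ofReal_neg, neg_smul]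
  · exact ⟨⟨D * u₀, hg₁mem⟩, hh.eigenvalues 0, hpos, hg₁conj⟩

/-- `det h = −λ²` for `g h g⋆ = λσ₃`, `g ∈ SU(2)`. [folklore] -/
theorem det_eq_of_conj_eq_smul_sigma3 {h : Matrix (Fin 2) (Fin 2) ℂ} {g : Matrix.specialUnitaryGroup (Fin 2) ℂ} {lam : ℝ}
    (hg : (g : Matrix (Fin 2) (Fin 2) ℂ) * h * star (g : Matrix (Fin 2) (Fin 2) ℂ) = (lam : ℂ) • σ₃) : h.det = -(lam : ℂ) ^ 2 := by
  have hgU : (g : Matrix (Fin 2) (Fin 2) ℂ) * star (g : Matrix (Fin 2) (Fin 2) ℂ) = 1 := Matrix.mem_unitaryGroup_iff.1 g.2.1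
  have hdet1 : (g : Matrix (Fin 2) (Fin 2) ℂ).det * (star (g : Matrix (Fin 2) (Fin 2) ℂ)).det = 1 := by
    rw [← Matrix.det_mul, hgU, Matrix.det_one]
  have h1 := congrArg Matrix.det hg
  rw [Matrix.det_mul, Matrix.det_mul, det_smul_sigma3] at h1
  calc h.det = (g : Matrix (Fin 2) (Fin 2) ℂ).det * h.det * (star (g : Matrix (Fin 2) (Fin 2) ℂ)).det := by
          rw [mul_comm ((g : Matrix (Fin 2) (Fin 2) ℂ).det), mul_assoc, hdet1, mul_one]
    _ = -(lam : ℂ) ^ 2 := h1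

end Matrices

/-! ## §2 The diagonalising gauge of a reducible coarse field -/

section Gauge

variable {P : Params}

/-- the matrix of an `SU(2)` bond variable read in the units (`bgUnits`∕`unitsField ∘ toUField` letter). [cite: Balaban1985Averaging, (19) p.21] -/
theorem coe_unitsField_toUField (V : GaugeField P 0 (Matrix.specialUnitaryGroup (Fin 2) ℂ)) (e : PBond P 0) :
    ((unitsField (toUField V) e : (Matrix (Fin 2) (Fin 2) ℂ)ˣ) : Matrix (Fin 2) (Fin 2) ℂ) = ((V e : Matrix.specialUnitaryGroup (Fin 2) ℂ) : Matrix (Fin 2) (Fin 2) ℂ) := by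
  rw [val_unitsField]; rfl

/-- ★★★ **THE σ₃-DIAGONALISING COARSE GAUGE.**  Let `V` be an `SU(2)` configuration and `h` a section of Hermitian traceless `2 × 2` matrices which is
`V♭`-PARALLEL (`h(e₋) = V(e)·h(e₊)·V(e)⁻¹`) and non-zero at some site.  Then there is a gauge transformation `g` such that EVERY bond variable of `g • V`
commutes with `σ₃` (i.e. `g • V` is diagonal): pointwise `g(y) h(y) g(y)⋆ = λ(y)σ₃` with `λ(y) > 0` (§1), `λ` is transported along bonds (`det h` is, Mathlib
`Matrix.det_units_conj`) so `λ(e₋) = λ(e₊)`, and `W(λσ₃) = (λσ₃)W` for `W = g(e₋)V(e)g(e₊)⁻¹`.  Non-vanishing propagates: `det h ≠ 0` is shift-invariant on the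
connected torus (✓`const_of_shift_eq`). [cite: Balaban1985BackgroundPropagators, (3.21) p.394; Balaban1985Averaging, (8) p.19] -/
theorem exists_gauge_commute_sigma3_of_parallel (V : GaugeField P 0 (Matrix.specialUnitaryGroup (Fin 2) ℂ)) (h : Site P 0 → Matrix (Fin 2) (Fin 2) ℂ)
    (hherm : ∀ y, (h y).IsHermitian) (htr : ∀ y, (h y).trace = 0)
    (hpar : ∀ e : PBond P 0, h e.src = ((unitsField (toUField V) e : (Matrix (Fin 2) (Fin 2) ℂ)ˣ) : Matrix (Fin 2) (Fin 2) ℂ) * h e.tgt *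
      (((unitsField (toUField V) e)⁻¹ : (Matrix (Fin 2) (Fin 2) ℂ)ˣ) : Matrix (Fin 2) (Fin 2) ℂ))
    (h0 : ∃ y, h y ≠ 0) :
    ∃ g : GaugeTransf P 0 (Matrix.specialUnitaryGroup (Fin 2) ℂ),
      ∀ e : PBond P 0, Commute ((GaugeField.gaugeAct g V e : Matrix.specialUnitaryGroup (Fin 2) ℂ) : Matrix (Fin 2) (Fin 2) ℂ) σ₃ := by
  -- `det h` is shift-invariant, hence constant; so `h ≠ 0` everywhere
  have hdet : ∀ e : PBond P 0, (h e.src).det = (h e.tgt).det := fun e => by rw [hpar e, Matrix.det_units_conj]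
  obtain ⟨y₀, hy₀⟩ := h0
  have hdet0 : ∀ y, (h y).det = (h y₀).det := by
    intro y
    have hs : ∀ (x : Site P 0) (μ : Fin P.d), (fun x => (h x).det) (x.shift μ) = (fun x => (h x).det) x := fun x μ => (hdet ⟨x, μ⟩).symm
    rw [const_of_shift_eq (fun x => (h x).det) hs y, const_of_shift_eq (fun x => (h x).det) hs y₀]
  have hne : ∀ y, h y ≠ 0 := by
    obtain ⟨g₀, lam₀, hlam₀, hg₀⟩ := exists_su2_conj_eq_smul_sigma3 (h y₀) (hherm y₀) (htr y₀) hy₀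
    have hd0 : (h y₀).det ≠ 0 := by
      rw [det_eq_of_conj_eq_smul_sigma3 hg₀]
      exact neg_ne_zero.2 (pow_ne_zero 2 (Complex.ofReal_ne_zero.2 hlam₀.ne'))
    intro y hy
    apply hd0
    rw [← hdet0 y, hy, Matrix.det_zero]
  -- pointwise diagonalisation
  choose g lam hlam hg using fun y => exists_su2_conj_eq_smul_sigma3 (h y) (hherm y) (htr y) (hne y)
  refine ⟨g, fun e => ?_⟩
  -- `λ` is transported along the bond
  have hlam_eq : lam e.tgt = lam e.src := by
    have h1 : -((lam e.src : ℝ) : ℂ) ^ 2 = -((lam e.tgt : ℝ) : ℂ) ^ 2 := by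
      rw [← det_eq_of_conj_eq_smul_sigma3 (hg e.src), ← det_eq_of_conj_eq_smul_sigma3 (hg e.tgt)]; exact hdet e
    have h2 : ((lam e.src ^ 2 : ℝ) : ℂ) = ((lam e.tgt ^ 2 : ℝ) : ℂ) := by push_cast; exact neg_injective h1
    have h3 := Complex.ofReal_injective h2
    exact ((sq_eq_sq₀ (hlam e.tgt).le (hlam e.src).le).1 h3.symm)
  -- parallelism as an intertwining `h(e₋)·V(e) = V(e)·h(e₊)`
  have hint : h e.src * ((V e : Matrix.specialUnitaryGroup (Fin 2) ℂ) : Matrix (Fin 2) (Fin 2) ℂ) =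
      ((V e : Matrix.specialUnitaryGroup (Fin 2) ℂ) : Matrix (Fin 2) (Fin 2) ℂ) * h e.tgt := by
    have h2 : h e.src * ((unitsField (toUField V) e : (Matrix (Fin 2) (Fin 2) ℂ)ˣ) : Matrix (Fin 2) (Fin 2) ℂ) =
        ((unitsField (toUField V) e : (Matrix (Fin 2) (Fin 2) ℂ)ˣ) : Matrix (Fin 2) (Fin 2) ℂ) * h e.tgt := by
      rw [hpar e, mul_assoc, Units.inv_mul, mul_one]
    rw [coe_unitsField_toUField] at h2
    exact h2
  -- the two ends are unitary
  have hGsU' : star ((g e.src : Matrix.specialUnitaryGroup (Fin 2) ℂ) : Matrix (Fin 2) (Fin 2) ℂ) *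
      ((g e.src : Matrix.specialUnitaryGroup (Fin 2) ℂ) : Matrix (Fin 2) (Fin 2) ℂ) = 1 := Matrix.mem_unitaryGroup_iff'.1 (g e.src).2.1
  have hGtU' : star ((g e.tgt : Matrix.specialUnitaryGroup (Fin 2) ℂ) : Matrix (Fin 2) (Fin 2) ℂ) *
      ((g e.tgt : Matrix.specialUnitaryGroup (Fin 2) ℂ) : Matrix (Fin 2) (Fin 2) ℂ) = 1 := Matrix.mem_unitaryGroup_iff'.1 (g e.tgt).2.1
  -- `g h = (λσ₃) g` at the source, `h g⋆ = g⋆ (λσ₃)` at the target (same `λ`)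
  have hs' : ((g e.src : Matrix.specialUnitaryGroup (Fin 2) ℂ) : Matrix (Fin 2) (Fin 2) ℂ) * h e.src =
      ((lam e.src : ℝ) : ℂ) • σ₃ * ((g e.src : Matrix.specialUnitaryGroup (Fin 2) ℂ) : Matrix (Fin 2) (Fin 2) ℂ) := by
    calc ((g e.src : Matrix.specialUnitaryGroup (Fin 2) ℂ) : Matrix (Fin 2) (Fin 2) ℂ) * h e.src
        = ((g e.src : Matrix.specialUnitaryGroup (Fin 2) ℂ) : Matrix (Fin 2) (Fin 2) ℂ) * h e.src *
            (star ((g e.src : Matrix.specialUnitaryGroup (Fin 2) ℂ) : Matrix (Fin 2) (Fin 2) ℂ) *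
              ((g e.src : Matrix.specialUnitaryGroup (Fin 2) ℂ) : Matrix (Fin 2) (Fin 2) ℂ)) := by rw [hGsU', mul_one]
      _ = ((g e.src : Matrix.specialUnitaryGroup (Fin 2) ℂ) : Matrix (Fin 2) (Fin 2) ℂ) * h e.src *
            star ((g e.src : Matrix.specialUnitaryGroup (Fin 2) ℂ) : Matrix (Fin 2) (Fin 2) ℂ) *
              ((g e.src : Matrix.specialUnitaryGroup (Fin 2) ℂ) : Matrix (Fin 2) (Fin 2) ℂ) := by simp only [mul_assoc]
      _ = ((lam e.src : ℝ) : ℂ) • σ₃ * ((g e.src : Matrix.specialUnitaryGroup (Fin 2) ℂ) : Matrix (Fin 2) (Fin 2) ℂ) := by rw [hg e.src]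
  have ht' : h e.tgt * star ((g e.tgt : Matrix.specialUnitaryGroup (Fin 2) ℂ) : Matrix (Fin 2) (Fin 2) ℂ) =
      star ((g e.tgt : Matrix.specialUnitaryGroup (Fin 2) ℂ) : Matrix (Fin 2) (Fin 2) ℂ) * (((lam e.src : ℝ) : ℂ) • σ₃) := by
    rw [← hlam_eq]
    calc h e.tgt * star ((g e.tgt : Matrix.specialUnitaryGroup (Fin 2) ℂ) : Matrix (Fin 2) (Fin 2) ℂ)
        = star ((g e.tgt : Matrix.specialUnitaryGroup (Fin 2) ℂ) : Matrix (Fin 2) (Fin 2) ℂ) *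
            ((g e.tgt : Matrix.specialUnitaryGroup (Fin 2) ℂ) : Matrix (Fin 2) (Fin 2) ℂ) * h e.tgt *
              star ((g e.tgt : Matrix.specialUnitaryGroup (Fin 2) ℂ) : Matrix (Fin 2) (Fin 2) ℂ) := by rw [hGtU', one_mul]
      _ = star ((g e.tgt : Matrix.specialUnitaryGroup (Fin 2) ℂ) : Matrix (Fin 2) (Fin 2) ℂ) *
            (((g e.tgt : Matrix.specialUnitaryGroup (Fin 2) ℂ) : Matrix (Fin 2) (Fin 2) ℂ) * h e.tgt *
              star ((g e.tgt : Matrix.specialUnitaryGroup (Fin 2) ℂ) : Matrix (Fin 2) (Fin 2) ℂ)) := by simp only [mul_assoc]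
      _ = star ((g e.tgt : Matrix.specialUnitaryGroup (Fin 2) ℂ) : Matrix (Fin 2) (Fin 2) ℂ) * (((lam e.tgt : ℝ) : ℂ) • σ₃) := by
          rw [hg e.tgt]
  -- the re-gauged bond variable `W = g(e₋)·V(e)·g(e₊)⋆` commutes with `λσ₃`
  have hW : ((GaugeField.gaugeAct g V e : Matrix.specialUnitaryGroup (Fin 2) ℂ) : Matrix (Fin 2) (Fin 2) ℂ) =
      ((g e.src : Matrix.specialUnitaryGroup (Fin 2) ℂ) : Matrix (Fin 2) (Fin 2) ℂ) *
        ((V e : Matrix.specialUnitaryGroup (Fin 2) ℂ) : Matrix (Fin 2) (Fin 2) ℂ) *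
          star ((g e.tgt : Matrix.specialUnitaryGroup (Fin 2) ℂ) : Matrix (Fin 2) (Fin 2) ℂ) := rfl
  have hcomm : Commute (((g e.src : Matrix.specialUnitaryGroup (Fin 2) ℂ) : Matrix (Fin 2) (Fin 2) ℂ) *
      ((V e : Matrix.specialUnitaryGroup (Fin 2) ℂ) : Matrix (Fin 2) (Fin 2) ℂ) *
        star ((g e.tgt : Matrix.specialUnitaryGroup (Fin 2) ℂ) : Matrix (Fin 2) (Fin 2) ℂ)) (((lam e.src : ℝ) : ℂ) • σ₃) := by
    show _ * _ = _ * _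
    calc ((g e.src : Matrix.specialUnitaryGroup (Fin 2) ℂ) : Matrix (Fin 2) (Fin 2) ℂ) *
          ((V e : Matrix.specialUnitaryGroup (Fin 2) ℂ) : Matrix (Fin 2) (Fin 2) ℂ) *
            star ((g e.tgt : Matrix.specialUnitaryGroup (Fin 2) ℂ) : Matrix (Fin 2) (Fin 2) ℂ) * (((lam e.src : ℝ) : ℂ) • σ₃)
        = ((g e.src : Matrix.specialUnitaryGroup (Fin 2) ℂ) : Matrix (Fin 2) (Fin 2) ℂ) *
            ((V e : Matrix.specialUnitaryGroup (Fin 2) ℂ) : Matrix (Fin 2) (Fin 2) ℂ) *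
              (h e.tgt * star ((g e.tgt : Matrix.specialUnitaryGroup (Fin 2) ℂ) : Matrix (Fin 2) (Fin 2) ℂ)) := by
          rw [ht']; simp only [mul_assoc]
      _ = ((g e.src : Matrix.specialUnitaryGroup (Fin 2) ℂ) : Matrix (Fin 2) (Fin 2) ℂ) *
            (h e.src * ((V e : Matrix.specialUnitaryGroup (Fin 2) ℂ) : Matrix (Fin 2) (Fin 2) ℂ)) *
              star ((g e.tgt : Matrix.specialUnitaryGroup (Fin 2) ℂ) : Matrix (Fin 2) (Fin 2) ℂ) := by
          rw [hint]; simp only [mul_assoc]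
      _ = ((lam e.src : ℝ) : ℂ) • σ₃ * (((g e.src : Matrix.specialUnitaryGroup (Fin 2) ℂ) : Matrix (Fin 2) (Fin 2) ℂ) *
            ((V e : Matrix.specialUnitaryGroup (Fin 2) ℂ) : Matrix (Fin 2) (Fin 2) ℂ) *
              star ((g e.tgt : Matrix.specialUnitaryGroup (Fin 2) ℂ) : Matrix (Fin 2) (Fin 2) ℂ)) := by
          rw [← mul_assoc ((g e.src : Matrix.specialUnitaryGroup (Fin 2) ℂ) : Matrix (Fin 2) (Fin 2) ℂ) (h e.src), hs']
          simp only [mul_assoc]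
  rw [hW]
  have hl : ((lam e.src : ℝ) : ℂ) ≠ 0 := Complex.ofReal_ne_zero.2 (hlam e.src).ne'
  have h2 := hcomm.smul_right (((lam e.src : ℝ) : ℂ))⁻¹
  rwa [inv_smul_smul₀ hl] at h2

end Gauge

/-! ## §3 Undoing the gauge: a centre for `w • V` gives a centre for `V` -/

section T3

variable (F : T3Family) {n K : ℕ}

/-- **A SYMMETRIC REGULAR CENTRE FOR A GAUGE COPY GIVES ONE FOR THE FIELD**: if `w • V` has a fibre point with `RegPr a`, `CloseAvg b` and `hLift`, so has `V`
(transport by `(liftTransfTo w⁻¹)`, ✓`symCentre_gaugeAct`, `w⁻¹ • (w • V) = V`). [cite: Balaban1985Variational, (3)-(6) p.278; Balaban1985Averaging, (11)-(13) p.19] -/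
theorem exists_symCentre_of_gaugeAct (h : n ≤ K) (w : GaugeTransf (F.P n) 0 (Matrix.specialUnitaryGroup (Fin 2) ℂ))
    {V : GaugeField (F.P n) 0 (Matrix.specialUnitaryGroup (Fin 2) ℂ)} {a b : ℝ} (ha : 0 ≤ a) (hb : 0 < b)
    (hW : ∃ U₁ : GaugeField (F.P K) 0 (Matrix.specialUnitaryGroup (Fin 2) ℂ),
      U₁ ∈ fibre F ℰp n K h (GaugeField.gaugeAct w V) ∧ RegPr F n K a U₁ ∧
      ∀ cf : Site (F.P K) (K - n) → Matrix (Fin 2) (Fin 2) ℂ,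
        (∀ e : PBond (F.P K) (K - n), cf e.src = ((emlIterU (K - n) (bgUnits F K U₁) e : (Matrix (Fin 2) (Fin 2) ℂ)ˣ) : Matrix (Fin 2) (Fin 2) ℂ) * cf e.tgt *
          (((emlIterU (K - n) (bgUnits F K U₁) e)⁻¹ : (Matrix (Fin 2) (Fin 2) ℂ)ˣ) : Matrix (Fin 2) (Fin 2) ℂ)) →
        ∃ l₀ : Site (F.P K) 0 → Matrix (Fin 2) (Fin 2) ℂ,
          (∀ b' : PBond (F.P K) 0, l₀ b'.src = ((bgUnits F K U₁ b' : (Matrix (Fin 2) (Fin 2) ℂ)ˣ) : Matrix (Fin 2) (Fin 2) ℂ) * l₀ b'.tgt * (((bgUnits F K U₁ b')⁻¹ : (Matrix (Fin 2) (Fin 2) ℂ)ˣ) : Matrix (Fin 2) (Fin 2) ℂ)) ∧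
          ∀ y : Site (F.P K) (K - n), l₀ (embIter (K - n) y) = cf y) :
    ∃ U₀ : GaugeField (F.P K) 0 (Matrix.specialUnitaryGroup (Fin 2) ℂ),
      U₀ ∈ fibre F ℰp n K h V ∧ RegPr F n K a U₀ ∧ CloseAvg F n K h b V U₀ ∧
      ∀ cf : Site (F.P K) (K - n) → Matrix (Fin 2) (Fin 2) ℂ,
        (∀ e : PBond (F.P K) (K - n), cf e.src = ((emlIterU (K - n) (bgUnits F K U₀) e : (Matrix (Fin 2) (Fin 2) ℂ)ˣ) : Matrix (Fin 2) (Fin 2) ℂ) * cf e.tgt *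
          (((emlIterU (K - n) (bgUnits F K U₀) e)⁻¹ : (Matrix (Fin 2) (Fin 2) ℂ)ˣ) : Matrix (Fin 2) (Fin 2) ℂ)) →
        ∃ l₀ : Site (F.P K) 0 → Matrix (Fin 2) (Fin 2) ℂ,
          (∀ b' : PBond (F.P K) 0, l₀ b'.src = ((bgUnits F K U₀ b' : (Matrix (Fin 2) (Fin 2) ℂ)ˣ) : Matrix (Fin 2) (Fin 2) ℂ) * l₀ b'.tgt * (((bgUnits F K U₀ b')⁻¹ : (Matrix (Fin 2) (Fin 2) ℂ)ˣ) : Matrix (Fin 2) (Fin 2) ℂ)) ∧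
          ∀ y : Site (F.P K) (K - n), l₀ (embIter (K - n) y) = cf y := by
  obtain ⟨U₁, hfib, hreg, hLift⟩ := hW
  have h4 := symCentre_gaugeAct F h (liftTransfTo F n K h fun x => (w x)⁻¹) ha hb hfib hreg hLift
  rw [descTransf_liftTransfTo, gaugeAct_gaugeAct] at h4
  have hV : GaugeField.gaugeAct (fun x => (w x)⁻¹ * w x) V = V := by
    funext b'; simp [GaugeField.gaugeAct]
  rw [hV] at h4
  exact ⟨_, h4⟩

end T3

end Summit.QuantumFields.YangMills.Theorems.Prop7NestedMeanParallelLiftDiagGauge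

end
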